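import Literature.NumberTheory.EllipticCurves.ShaIsogeny
import Literature.NumberTheory.EllipticCurves.IsogenyTwoTorsionProofs
import Literature.NumberTheory.EllipticCurves.ThreeIsogeny
import Literature.NumberTheory.EllipticCurves.IsogenyQuadraticTwistProofs
import Literature.NumberTheory.EllipticCurves.IsogenyIdProofs
import HarnessLib

/-!
# Local points maps of explicit isogenies

Instances of the geometric fact `WeierstrassCurve.Isogeny.hasLocalPointsMaps` of
`ShaIsogeny.lean` (an isogeny defined over `K` acts, `Γ_E`-equivariantly and compatibly with the
chosen embedding `K̄ → K̄_E`, on the `K̄_E`-points for every field `E ⊇ K` — the input that makes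
`Ш` functorial along the isogeny, `Literature.NumberTheory.EllipticCurves.galH1Map_mem_sha`), **proved** for isogenies of the tree
that are given by universal formulas with coefficients in `K`, hence make sense over every
extension:

* `WeierstrassCurve.twoIsogenyPointsHom W L`: Silverman's explicit `2`-isogeny
  `y² = x³ + ax² + bx → Y² = X³ - 2aX² + (a² - 4b)X`, `(x, y) ↦ ((x² + ax + b)/x, y(x² - b)/x²)`
  (`IsogenyTwoTorsionProofs`: `twoIsogenyHom` over any field) on the `L`-points for any `K`-field
  `L`; `map_twoIsogenyPointsHom`: it commutes with the maps on points induced by `K`-algebra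
  homomorphisms `L → L'` (the formulas have coefficients `a, b ∈ K`);
  `hasLocalPointsMaps_twoIsogeny`: hence `Literature.NumberTheory.EllipticCurves.HasLocalPointsMaps` holds for `W.twoIsogeny`.

* `WeierstrassCurve.IsVeluThreePair.map_pointFun`: Vélu's `3`-isogeny
  `(x, y) ↦ ((x³ + 4msx + 4s²)/x², y(x³ - 4msx - 8s²)/x³)` of a Vélu pair (`ThreeIsogeny`:
  `IsVeluThreePair.pointHom` over any field containing `m, s`) commutes with the maps on points
  induced by `K`-algebra homomorphisms; `IsVeluThreePair.hasLocalPointsMaps_toIsogeny`: hence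
  `Literature.NumberTheory.EllipticCurves.HasLocalPointsMaps` holds for `h.toIsogeny`.
* `WeierstrassCurve.exists_isogeny_hasLocalPointsMaps_of_smul_eq`: `K`-isomorphic equations
  (`C • W = W'`, in either direction) are joined by isogenies with local points maps
  (`Literature.NumberTheory.EllipticCurves.HasLocalPointsMaps.toIsogeny`).
* Quadratic twists: `WeierstrassCurve.untwistAt`, `untwistEquivAt` (the untwisting isomorphism
  `ι_θ : V^{(d)}(L) ≃+ V(L)`, `(x, y) ↦ (x/θ², y/θ³)`, over any `K`-field `L` with a square root
  `θ` of `d`, generalising the tree's `untwist`/`untwistEquiv` over `K̄`), its behaviour under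
  `K`-algebra maps `f` with `f θ = ±θ'` (`map_untwistEquivAt_of_eq`/`_of_eq_neg`),
  `twistHomAt` (the twist `ι'⁻¹ ∘ φ_L ∘ ι` of a homomorphism of `L`-points, generalising
  `Isogeny.twistHom`), `map_twistHomAt` (the sign analysis of `Isogeny.twistHom_smul` for an
  arbitrary `f`), and `Literature.NumberTheory.EllipticCurves.HasLocalPointsMaps.quadraticTwist`: local points maps of `φ` give
  local points maps of `φ.quadraticTwist hd`.
* `WeierstrassCurve.IsLocIsogenous W W'` (`∃ φ : Isogeny W W'` with local points maps): the
  relation consumed by `Isogeny.shaFinite_of_shaFinite` (a binary predicate, not a closed named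
  fact), with `refl`, `trans'`, `isLocIsogenous_smul`/`_of_smul`, `quadraticTwist`,
  `shaFinite_of_shaFinite`, `isLocIsogenous_of_eq_twoIsogenyCodomain`,
  `IsVeluThreePair.isLocIsogenous`, and `isLocIsogenous_iff_isIsogenous` (it coincides with
  `IsIsogenous` under the named fact `Isogeny.hasLocalPointsMaps` of `ShaIsogeny.lean`).

Together these cover the explicit isogenies used for the CM curves of discriminant
`-12, -16, -27, -28` in `ComplexMultiplicationMaximalOrderProofs.lean`, including their transport
along `j` by changes of variables and quadratic twists
(`ComplexMultiplicationShaLocalProofs.lean`).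

## References

* J. H. Silverman, *The Arithmetic of Elliptic Curves*, 2nd ed. (2009), III.3.1(b), III.4
  Example 4.5, III.4.12–13, VIII.§1 (Galois action on coordinates). [SilvermanAEC2009]
* J. Vélu, *Isogénies entre courbes elliptiques*, C. R. Acad. Sci. Paris 273 (1971), 238–241
  (through `ThreeIsogeny.lean`).
* J. E. Cremona, *Algorithms for Modular Elliptic Curves*, 2nd ed. (1997), §3.8–3.9 (twisting
  commutes with isogenies). [CremonaAlgorithms1997]
* J. S. Milne, *Arithmetic Duality Theorems*, 2nd ed. (2006), Ch. I Lemma 7.1(b), p. 96 (the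
  `shaFinite_of_shaFinite` corollaries, through `ShaIsogeny.lean`). [MilneADT2006]
-/

noncomputable section

open scoped Classical

universe u v w

namespace WeierstrassCurve

variable {K : Type u} [Field K] (W : WeierstrassCurve K) [W.IsTwoTorsionNF] [W.IsElliptic]

/-- The explicit `2`-isogeny on `L`-points, for any field `L ⊇ K`:
`twoIsogenyHom (W ⊗ L)` followed by the transport along `(W ⊗ L)₂ = W₂ ⊗ L`
(`twoIsogenyCodomain_baseChange`). For `L = K̄` this is `W.twoIsogenyGeomHom`
(`twoIsogenyGeomHom_eq_twoIsogenyPointsHom`). Silverman, *AEC*, III.4.5. [folklore] -/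
def twoIsogenyPointsHom (L : Type v) [Field L] [Algebra K L] :
    (W.baseChange L).toAffine.Point →+ (W.twoIsogenyCodomain.baseChange L).toAffine.Point :=
  (Affine.Point.congrEquiv (twoIsogenyCodomain_baseChange W L)).toAddMonoidHom.comp
    (twoIsogenyHom (W.baseChange L))

/-- `twoIsogenyGeomHom` is `twoIsogenyPointsHom` over `K̄` (definitional). [folklore] -/
theorem twoIsogenyGeomHom_eq_twoIsogenyPointsHom :
    W.twoIsogenyGeomHom = W.twoIsogenyPointsHom (AlgebraicClosure K) :=
  rfl

/-- `twoIsogenyPointsHom` on an affine point with `x = 0` (i.e. on `T = (0,0)`): `O`. [folklore] -/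
theorem twoIsogenyPointsHom_some_of_eq_zero {L : Type v} [Field L] [Algebra K L] {x y : L}
    (h : (W.baseChange L).toAffine.Nonsingular x y) (hx : x = 0) :
    W.twoIsogenyPointsHom L (.some x y h) = 0 := by
  simp [twoIsogenyPointsHom, twoIsogenyFun_some_of_eq_zero _ h hx, Affine.Point.congrEquiv_zero]

/-- `twoIsogenyPointsHom` on an affine point with `x ≠ 0`:
`((x² + ax + b)/x, y(x² - b)/x²)` with `a, b` read in `L`. [folklore] -/
theorem twoIsogenyPointsHom_some {L : Type v} [Field L] [Algebra K L] {x y : L}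
    (h : (W.baseChange L).toAffine.Nonsingular x y) (hx : x ≠ 0) :
    ∃ h', W.twoIsogenyPointsHom L (.some x y h) =
      .some ((W.baseChange L).twoIsogenyX x) ((W.baseChange L).twoIsogenyY x y) h' := by
  refine ⟨(twoIsogenyCodomain_baseChange W L) ▸ nonsingular_twoIsogeny _ h.left hx, ?_⟩
  simp [twoIsogenyPointsHom, twoIsogenyFun_some _ _ hx, Affine.Point.congrEquiv_some]

/-- **The explicit `2`-isogeny commutes with the maps on points induced by `K`-algebra
homomorphisms** `f : L → L'` of fields over `K` (its formulas have coefficients `a, b ∈ K`):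
`f_* ∘ φ_L = φ_{L'} ∘ f_*`. Silverman, *AEC*, III.4.5 with VIII.§1. [folklore] -/
theorem map_twoIsogenyPointsHom {L : Type v} [Field L] [Algebra K L] {L' : Type w} [Field L']
    [Algebra K L'] (f : L →ₐ[K] L') (P : (W.baseChange L).toAffine.Point) :
    Affine.Point.map f (W.twoIsogenyPointsHom L P) =
      W.twoIsogenyPointsHom L' (Affine.Point.map f P) := by
  rcases P with _ | ⟨x, y, h⟩
  · simp only [← Affine.Point.zero_def, map_zero]
  · by_cases hx : x = 0
    · rw [twoIsogenyPointsHom_some_of_eq_zero W h hx, map_zero, Affine.Point.map_some,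
        twoIsogenyPointsHom_some_of_eq_zero W _ (by rw [hx, map_zero])]
    · obtain ⟨h₁, e₁⟩ := twoIsogenyPointsHom_some W h hx
      have hfx : f x ≠ 0 := (map_ne_zero f).mpr hx
      obtain ⟨h₂, e₂⟩ := twoIsogenyPointsHom_some W (L := L')
        ((Affine.baseChange_nonsingular (W := W) f.injective x y).mpr h) hfx
      rw [e₁, Affine.Point.map_some, Affine.Point.map_some, e₂]
      congr 1
      · simp only [twoIsogenyX, map_div₀, map_add, map_mul, map_pow, baseChange, map_a₂, map_a₄,
          AlgHom.commutes]
      · simp only [twoIsogenyY, map_div₀, map_sub, map_mul, map_pow, baseChange, map_a₄,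
          AlgHom.commutes]

/-- **The explicit `2`-isogeny has local points maps** (`Literature.NumberTheory.EllipticCurves.HasLocalPointsMaps`, hence the
hypothesis of `WeierstrassCurve.Isogeny.shaFinite_of_shaFinite` holds for it unconditionally):
at a `K`-field `E` take `twoIsogenyPointsHom W K̄_E`; `Γ_E`-equivariance and compatibility with
`K̄ → K̄_E` are both instances of `map_twoIsogenyPointsHom`. Silverman, *AEC*, III.4.5.
[folklore] -/
theorem hasLocalPointsMaps_twoIsogeny :
    Literature.NumberTheory.EllipticCurves.HasLocalPointsMaps W W.twoIsogenyCodomain W.twoIsogeny.toAddMonoidHom := by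
  intro E _ _
  refine ⟨W.twoIsogenyPointsHom (AlgebraicClosure E), fun τ P ↦ ?_, fun P ↦ ?_⟩
  · rw [Literature.NumberTheory.EllipticCurves.localPoints.smul_def, Literature.NumberTheory.EllipticCurves.localPoints.smul_def]
    exact (W.map_twoIsogenyPointsHom _ P).symm
  · exact (W.map_twoIsogenyPointsHom (Literature.NumberTheory.EllipticCurves.closureEmb (K := K) E) P).symm

/-- Consequently, for Silverman's `2`-isogeny over a number field, `Ш(E₂/K)` finite implies
`Ш(E₁/K)` finite, unconditionally (`Isogeny.shaFinite_of_shaFinite` with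
`hasLocalPointsMaps_twoIsogeny`). Milne, *ADT*, Lemma I.7.1(b).
[cite: MilneADT2006, Ch. I Lemma 7.1(b), p. 96] -/
theorem shaFinite_of_shaFinite_twoIsogenyCodomain [NumberField K]
    (h : W.twoIsogenyCodomain.ShaFinite) : W.ShaFinite :=
  W.twoIsogeny.shaFinite_of_shaFinite (hasLocalPointsMaps_twoIsogeny W) h

/-! ## Vélu's `3`-isogeny -/

namespace IsVeluThreePair

variable {m s : K} {V V' : WeierstrassCurve K}

/-- **Vélu's `3`-isogeny commutes with the maps on points induced by `K`-algebra homomorphisms**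
`f : L → L'` of fields over `K` (its formula has coefficients in `K`): for the base-changed pairs
over `L` and `L'`, `f_* ∘ φ_L = φ_{L'} ∘ f_*` (the computation of `IsVeluThreePair.geomHom_smul`,
for an arbitrary `f`). Vélu (1971); Silverman, *AEC*, III.4.12–13 with VIII.§1. [folklore] -/
theorem map_pointFun (h : IsVeluThreePair m s V V') {L : Type v} [Field L] [Algebra K L]
    {L' : Type w} [Field L'] [Algebra K L'] (f : L →ₐ[K] L')
    (P : (V.baseChange L).toAffine.Point) :
    Affine.Point.map f ((h.baseChange L).pointFun P) =
      (h.baseChange L').pointFun (Affine.Point.map f P) := by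
  rcases P with _ | ⟨x, y, hxy⟩
  · rfl
  · rw [Affine.Point.map_some]
    by_cases hx : x = 0
    · have hfx : f x = 0 := by rw [hx, map_zero]
      rw [(h.baseChange L').pointFun_some_of_eq_zero _ hfx,
        (h.baseChange L).pointFun_some_of_eq_zero _ hx, Affine.Point.map_zero]
    · have hfx : f x ≠ 0 := (map_ne_zero f).mpr hx
      rw [(h.baseChange L').pointFun_some _ hfx, (h.baseChange L).pointFun_some _ hx,
        Affine.Point.map_some]
      congr 1 <;>
        simp [IsVeluThreePair.X, IsVeluThreePair.Y, map_div₀, map_ofNat, AlgHom.commutes]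

/-- **Vélu's `3`-isogeny has local points maps** (`Literature.NumberTheory.EllipticCurves.HasLocalPointsMaps` for `h.toIsogeny`):
at a `K`-field `E` take `(h.baseChange K̄_E).pointHom`; equivariance and compatibility with
`K̄ → K̄_E` are instances of `map_pointFun`. [folklore] -/
theorem hasLocalPointsMaps_toIsogeny (h : IsVeluThreePair m s V V') :
    Literature.NumberTheory.EllipticCurves.HasLocalPointsMaps V V' h.toIsogeny.toAddMonoidHom := by
  intro E _ _
  refine ⟨(h.baseChange (AlgebraicClosure E)).pointHom, fun τ P ↦ ?_, fun P ↦ ?_⟩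
  · rw [Literature.NumberTheory.EllipticCurves.localPoints.smul_def, Literature.NumberTheory.EllipticCurves.localPoints.smul_def]
    exact (h.map_pointFun _ P).symm
  · exact (h.map_pointFun (Literature.NumberTheory.EllipticCurves.closureEmb (K := K) E) P).symm

/-- Consequently, along Vélu's `3`-isogeny `W → W'` over a number field, `Ш(W'/K)` finite
implies `Ш(W/K)` finite, unconditionally. Milne, *ADT*, Lemma I.7.1(b).
[cite: MilneADT2006, Ch. I Lemma 7.1(b), p. 96] -/
theorem shaFinite_of_shaFinite [NumberField K] [V.IsElliptic] [V'.IsElliptic]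
    (h : IsVeluThreePair m s V V') (hfin : V'.ShaFinite) : V.ShaFinite :=
  h.toIsogeny.shaFinite_of_shaFinite h.hasLocalPointsMaps_toIsogeny hfin

end IsVeluThreePair

/-! ## Isomorphic equations -/

omit [W.IsTwoTorsionNF] [W.IsElliptic] in
/-- **`K`-isomorphic equations are joined by an isogeny with local points maps**: if
`C • W = W'` then the substitution isogeny `W → W'` (`VariableChange.toIsogeny`, transported
along the equality) has local points maps (`Literature.NumberTheory.EllipticCurves.HasLocalPointsMaps.toIsogeny`).
Silverman, *AEC*, III.3.1(b). [folklore] -/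
theorem exists_isogeny_hasLocalPointsMaps_of_smul_eq {W' : WeierstrassCurve K}
    {C : VariableChange K} (h : C • W = W') :
    ∃ φ : Isogeny W W', Literature.NumberTheory.EllipticCurves.HasLocalPointsMaps W W' φ.toAddMonoidHom := by
  subst h
  exact ⟨VariableChange.toIsogeny W C, Literature.NumberTheory.EllipticCurves.HasLocalPointsMaps.toIsogeny W C⟩

omit [W.IsTwoTorsionNF] [W.IsElliptic] in
/-- The same in the opposite direction: if `C • W = W'` then there is an isogeny `W' → W` with
local points maps (the substitution `C⁻¹`). Silverman, *AEC*, III.3.1(b). [folklore] -/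
theorem exists_isogeny_hasLocalPointsMaps_of_smul_eq' {W' : WeierstrassCurve K}
    {C : VariableChange K} (h : C • W = W') :
    ∃ φ : Isogeny W' W, Literature.NumberTheory.EllipticCurves.HasLocalPointsMaps W' W φ.toAddMonoidHom := by
  have h' : C⁻¹ • W' = W := by rw [← h, inv_smul_smul]
  exact exists_isogeny_hasLocalPointsMaps_of_smul_eq W' h'

/-! ## Quadratic twists: the untwisting isomorphism over any field containing `√d` -/

section UntwistAt

variable {d : K} {L : Type v} [Field L] [Algebra K L] {θ : L}
  {L' : Type w} [Field L'] [Algebra K L'] {θ' : L'}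

omit [W.IsTwoTorsionNF] [W.IsElliptic]

/-- The change of variables `C_θ = (u, r, s, t) = (θ, 0, 0, 0)` over a field `L ∋ θ` (meant
for `θ = √d`): the tree's `WeierstrassCurve.untwist` (`IsogenyQuadraticTwistProofs`, over `K̄`
with `θ = geomSqrt d`) over an arbitrary field. Silverman, *AEC*, X.2 (proof of Prop. 2.4), X.5
Cor. 5.4(iii). [folklore] -/
def untwistAt (hθ : θ ≠ 0) : VariableChange L :=
  ⟨Units.mk0 θ hθ, 0, 0, 0⟩

/-- `C_θ.toX x = x/θ²`. [folklore] -/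
@[simp]
theorem toX_untwistAt (hθ : θ ≠ 0) (x : L) : (untwistAt hθ).toX x = (θ ^ 2)⁻¹ * x := by
  simp [VariableChange.toX_def, untwistAt, Units.val_inv_eq_inv_val, inv_pow]

/-- `C_θ.toY x y = y/θ³`. [folklore] -/
@[simp]
theorem toY_untwistAt (hθ : θ ≠ 0) (x y : L) : (untwistAt hθ).toY x y = (θ ^ 3)⁻¹ * y := by
  simp [VariableChange.toY_def, untwistAt, Units.val_inv_eq_inv_val, inv_pow]

variable [NeZero (2 : K)]

/-- **`C_θ • V^{(d)}_L = V^{(1)}_L` when `θ² = d`** (Silverman, *AEC*, X.5 Cor. 5.4(iii):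
`E^{(d)} ≅ E` over any field containing `√d`); the computation of the tree's `untwist_smul`
with `geomSqrt d` replaced by an arbitrary square root `θ` in an arbitrary `K`-field `L`.
[cite: SilvermanAEC2009, X.5 Cor. 5.4] -/
theorem untwistAt_smul (hθ2 : θ ^ 2 = algebraMap K L d) (hθ : θ ≠ 0) :
    untwistAt hθ • (W.quadraticTwist d).baseChange L = (W.quadraticTwist 1).baseChange L := by
  have h2K : (2 : L) ≠ 0 := by
    rw [← map_ofNat (algebraMap K L) 2, map_ne_zero]
    exact two_ne_zero
  have h4 : (4 : L) ≠ 0 := by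
    rw [show (4 : L) = 2 * 2 by norm_num]
    exact mul_ne_zero h2K h2K
  ext
  · simp [untwistAt, baseChange, variableChange_a₁]
  · simp only [untwistAt, baseChange, variableChange_a₂, map_a₁, map_a₂, quadraticTwist_a₁,
      quadraticTwist_a₂, map_zero, mul_zero, sub_zero, add_zero, one_mul,
      zero_pow two_ne_zero, map_div₀, map_mul, ← hθ2, map_ofNat, inv_pow,
      Units.val_inv_eq_inv_val, Units.val_mk0]
    field_simp
  · simp [untwistAt, baseChange, variableChange_a₃]
  · simp only [untwistAt, baseChange, variableChange_a₄, map_a₁, map_a₂, map_a₃, map_a₄,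
      quadraticTwist_a₁, quadraticTwist_a₂, quadraticTwist_a₃, quadraticTwist_a₄, map_zero,
      mul_zero, sub_zero, add_zero, zero_mul, one_pow, one_mul, map_div₀, map_mul, map_pow,
      ← hθ2, map_ofNat, inv_pow, Units.val_inv_eq_inv_val, Units.val_mk0, zero_pow two_ne_zero]
    field_simp
  · simp only [untwistAt, baseChange, variableChange_a₆, map_a₁, map_a₂, map_a₃, map_a₄,
      map_a₆, quadraticTwist_a₁, quadraticTwist_a₂, quadraticTwist_a₃, quadraticTwist_a₄,
      quadraticTwist_a₆, map_zero, mul_zero, sub_zero, add_zero, zero_mul, one_pow, one_mul,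
      map_div₀, map_mul, map_pow, ← hθ2, map_ofNat, inv_pow, Units.val_inv_eq_inv_val,
      Units.val_mk0, zero_pow two_ne_zero, zero_pow three_ne_zero]
    field_simp

/-- For a model with `a₁ = a₃ = 0`: `C_θ • V^{(d)}_L = V_L` (`untwistAt_smul` and
`quadraticTwist_one_eq_self`). [cite: SilvermanAEC2009, X.5 Cor. 5.4] -/
theorem untwistAt_smul_eq [W.IsCharNeTwoNF] (hθ2 : θ ^ 2 = algebraMap K L d) (hθ : θ ≠ 0) :
    untwistAt hθ • (W.quadraticTwist d).baseChange L = W.baseChange L := by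
  rw [untwistAt_smul W hθ2 hθ, quadraticTwist_one_eq_self]

variable [W.IsCharNeTwoNF]

/-- **The `L`-isomorphism `ι_θ : V^{(d)}(L) ≃+ V(L)`, `(x, y) ↦ (x/θ², y/θ³)`**, for a model with
`a₁ = a₃ = 0` and a square root `θ` of `d` in the `K`-field `L`: the tree's `untwistEquiv`
(`L = K̄`, `θ = geomSqrt d`) over an arbitrary field (`untwistEquiv_eq_untwistEquivAt`).
Silverman, *AEC*, X.5 Cor. 5.4(iii). [cite: SilvermanAEC2009, X.5 Cor. 5.4] -/
def untwistEquivAt (hθ2 : θ ^ 2 = algebraMap K L d) (hθ : θ ≠ 0) :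
    ((W.quadraticTwist d).baseChange L).toAffine.Point ≃+ (W.baseChange L).toAffine.Point :=
  (VariableChange.pointEquiv ((W.quadraticTwist d).baseChange L) (untwistAt hθ)).trans
    (Affine.Point.congrEquiv (untwistAt_smul_eq W hθ2 hθ))

/-- `ι_θ` on an affine point: `(x, y) ↦ (x/θ², y/θ³)`. [folklore] -/
theorem untwistEquivAt_some (hθ2 : θ ^ 2 = algebraMap K L d) (hθ : θ ≠ 0) {x y : L}
    (h : ((W.quadraticTwist d).baseChange L).toAffine.Nonsingular x y) :
    ∃ h', untwistEquivAt W hθ2 hθ (.some x y h) =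
      (.some ((θ ^ 2)⁻¹ * x) ((θ ^ 3)⁻¹ * y) h' : (W.baseChange L).toAffine.Point) := by
  have h' : (W.baseChange L).toAffine.Nonsingular ((θ ^ 2)⁻¹ * x) ((θ ^ 3)⁻¹ * y) := by
    rw [← toX_untwistAt hθ, ← toY_untwistAt hθ x y, ← untwistAt_smul_eq W hθ2 hθ,
      VariableChange.nonsingular_iff]
    exact h
  refine ⟨h', ?_⟩
  show Affine.Point.congrEquiv _ (VariableChange.pointEquiv _ _ (.some x y h)) = _
  rw [VariableChange.pointEquiv_some, Affine.Point.congrEquiv_some]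
  simp only [Affine.Point.some.injEq]
  exact ⟨toX_untwistAt hθ x, toY_untwistAt hθ x y⟩

/-- The tree's `untwistEquiv V hd` (over `K̄`, `θ = geomSqrt d`) is `untwistEquivAt`
(definitional). [folklore] -/
theorem untwistEquiv_eq_untwistEquivAt (hd : d ≠ 0) :
    untwistEquiv W hd = untwistEquivAt W (geomSqrt_sq d) (geomSqrt_ne_zero hd) :=
  rfl

omit [NeZero (2 : K)] [W.IsCharNeTwoNF] in
/-- Negation on `V_L` for a model with `a₁ = a₃ = 0` is `(x, y) ↦ (x, -y)`. [folklore] -/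
theorem negY_baseChange_of_isCharNeTwoNF' [W.IsCharNeTwoNF] (x y : L) :
    (W.baseChange L).toAffine.negY x y = -y := by
  simp [Affine.negY, baseChange, a₁_of_isCharNeTwoNF, a₃_of_isCharNeTwoNF]

/-- **`ι` commutes with `f_*` when `f θ = θ'`**: for a `K`-algebra homomorphism `f : L → L'`
carrying the chosen root `θ` of `d` to the chosen root `θ'`,
`f_* (ι_θ P) = ι_{θ'} (f_* P)`. [folklore] -/
theorem map_untwistEquivAt_of_eq (hθ2 : θ ^ 2 = algebraMap K L d) (hθ : θ ≠ 0)
    (hθ'2 : θ' ^ 2 = algebraMap K L' d) (hθ' : θ' ≠ 0) (f : L →ₐ[K] L') (hf : f θ = θ')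
    (P : ((W.quadraticTwist d).baseChange L).toAffine.Point) :
    Affine.Point.map f (untwistEquivAt W hθ2 hθ P) =
      untwistEquivAt W hθ'2 hθ' (Affine.Point.map f P) := by
  rcases P with _ | ⟨x, y, h⟩
  · simp only [← Affine.Point.zero_def, map_zero]
  · obtain ⟨h₁, e₁⟩ := untwistEquivAt_some W hθ2 hθ h
    obtain ⟨h₂, e₂⟩ := untwistEquivAt_some W hθ'2 hθ'
      ((Affine.baseChange_nonsingular (W := W.quadraticTwist d) f.injective x y).mpr h)
    rw [e₁, Affine.Point.map_some, Affine.Point.map_some, e₂]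
    congr 1 <;> simp only [map_mul, map_inv₀, map_pow, hf]

/-- **`ι` anticommutes with `f_*` when `f θ = -θ'`**: `f_* (ι_θ P) = -ι_{θ'} (f_* P)` (negation
on `V_{L'}` being `(x, y) ↦ (x, -y)`). [folklore] -/
theorem map_untwistEquivAt_of_eq_neg (hθ2 : θ ^ 2 = algebraMap K L d) (hθ : θ ≠ 0)
    (hθ'2 : θ' ^ 2 = algebraMap K L' d) (hθ' : θ' ≠ 0) (f : L →ₐ[K] L') (hf : f θ = -θ')
    (P : ((W.quadraticTwist d).baseChange L).toAffine.Point) :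
    Affine.Point.map f (untwistEquivAt W hθ2 hθ P) =
      -untwistEquivAt W hθ'2 hθ' (Affine.Point.map f P) := by
  rcases P with _ | ⟨x, y, h⟩
  · simp only [← Affine.Point.zero_def, map_zero, neg_zero]
  · obtain ⟨h₁, e₁⟩ := untwistEquivAt_some W hθ2 hθ h
    obtain ⟨h₂, e₂⟩ := untwistEquivAt_some W hθ'2 hθ'
      ((Affine.baseChange_nonsingular (W := W.quadraticTwist d) f.injective x y).mpr h)
    rw [e₁, Affine.Point.map_some, Affine.Point.map_some, e₂, Affine.Point.neg_some]
    congr 1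
    · simp only [map_mul, map_inv₀, map_pow, hf, Even.neg_pow (by decide : Even 2)]
    · simp only [negY_baseChange_of_isCharNeTwoNF', map_mul, map_inv₀, map_pow, hf,
        Odd.neg_pow (by decide : Odd 3), inv_neg, neg_mul]

/-- `ι⁻¹` commutes with `f_*` when `f θ = θ'`. [folklore] -/
theorem map_untwistEquivAt_symm_of_eq (hθ2 : θ ^ 2 = algebraMap K L d) (hθ : θ ≠ 0)
    (hθ'2 : θ' ^ 2 = algebraMap K L' d) (hθ' : θ' ≠ 0) (f : L →ₐ[K] L') (hf : f θ = θ')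
    (Q : (W.baseChange L).toAffine.Point) :
    Affine.Point.map f ((untwistEquivAt W hθ2 hθ).symm Q) =
      (untwistEquivAt W hθ'2 hθ').symm (Affine.Point.map f Q) := by
  apply (untwistEquivAt W hθ'2 hθ').injective
  rw [AddEquiv.apply_symm_apply, ← map_untwistEquivAt_of_eq W hθ2 hθ hθ'2 hθ' f hf,
    AddEquiv.apply_symm_apply]

/-- `ι⁻¹` anticommutes with `f_*` when `f θ = -θ'`. [folklore] -/
theorem map_untwistEquivAt_symm_of_eq_neg (hθ2 : θ ^ 2 = algebraMap K L d) (hθ : θ ≠ 0)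
    (hθ'2 : θ' ^ 2 = algebraMap K L' d) (hθ' : θ' ≠ 0) (f : L →ₐ[K] L') (hf : f θ = -θ')
    (Q : (W.baseChange L).toAffine.Point) :
    Affine.Point.map f ((untwistEquivAt W hθ2 hθ).symm Q) =
      -(untwistEquivAt W hθ'2 hθ').symm (Affine.Point.map f Q) := by
  apply (untwistEquivAt W hθ'2 hθ').injective
  rw [map_neg, AddEquiv.apply_symm_apply]
  have h := map_untwistEquivAt_of_eq_neg W hθ2 hθ hθ'2 hθ' f hf
    ((untwistEquivAt W hθ2 hθ).symm Q)
  rw [AddEquiv.apply_symm_apply] at h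
  rw [h, neg_neg]

end UntwistAt

/-! ## Quadratic twists: twisting a homomorphism of points, and local points maps -/

section TwistAt

variable [NeZero (2 : K)] {V V' : WeierstrassCurve K} [V.IsCharNeTwoNF] [V'.IsCharNeTwoNF]
  {d : K} {L : Type v} [Field L] [Algebra K L] {θ : L}
  {L' : Type w} [Field L'] [Algebra K L'] {θ' : L'}

variable (V V') in
/-- **The twist `ψ_L = ι'⁻¹ ∘ φ_L ∘ ι` of a homomorphism of `L`-points `φ_L : V(L) → V'(L)`**
(models with `a₁ = a₃ = 0`, `θ` a square root of `d` in `L`): the tree's `Isogeny.twistHom`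
(`L = K̄`) over an arbitrary field (`twistHom_eq_twistHomAt`). Cremona, *Algorithms*, §3.9.
[folklore] -/
def twistHomAt (φL : (V.baseChange L).toAffine.Point →+ (V'.baseChange L).toAffine.Point)
    (hθ2 : θ ^ 2 = algebraMap K L d) (hθ : θ ≠ 0) :
    ((V.quadraticTwist d).baseChange L).toAffine.Point →+
      ((V'.quadraticTwist d).baseChange L).toAffine.Point :=
  (untwistEquivAt V' hθ2 hθ).symm.toAddMonoidHom.comp
    (φL.comp (untwistEquivAt V hθ2 hθ).toAddMonoidHom)

/-- Unfolding `twistHomAt`. [folklore] -/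
theorem twistHomAt_apply
    (φL : (V.baseChange L).toAffine.Point →+ (V'.baseChange L).toAffine.Point)
    (hθ2 : θ ^ 2 = algebraMap K L d) (hθ : θ ≠ 0)
    (P : ((V.quadraticTwist d).baseChange L).toAffine.Point) :
    twistHomAt V V' φL hθ2 hθ P =
      (untwistEquivAt V' hθ2 hθ).symm (φL (untwistEquivAt V hθ2 hθ P)) :=
  rfl

/-- The tree's `Isogeny.twistHom φ hd` is `twistHomAt` over `K̄` (definitional). [folklore] -/
theorem twistHom_eq_twistHomAt (φ : Isogeny V V') (hd : d ≠ 0) :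
    Isogeny.twistHom φ hd =
      twistHomAt V V' φ.toAddMonoidHom (geomSqrt_sq d) (geomSqrt_ne_zero hd) :=
  rfl

/-- **Twisted homomorphisms commute with `f_*` whenever the untwisted ones do**: if
`f_* ∘ φ_L = φ_{L'} ∘ f_*` for a `K`-algebra homomorphism `f : L → L'` with `f θ = ±θ'`, then
`f_* ∘ ψ_L = ψ_{L'} ∘ f_*`. For `f θ = θ'` all three factors commute with `f_*`; for
`f θ = -θ'`, `ι` and `ι'⁻¹` anticommute and the two signs cancel through the additive `φ_{L'}`
(the argument of the tree's `Isogeny.twistHom_smul`). Cremona, *Algorithms*, §3.9; Silverman,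
*AEC*, X.2 (proof of Prop. 2.4). [folklore] -/
theorem map_twistHomAt (hθ2 : θ ^ 2 = algebraMap K L d) (hθ : θ ≠ 0)
    (hθ'2 : θ' ^ 2 = algebraMap K L' d) (hθ' : θ' ≠ 0) (f : L →ₐ[K] L')
    (hf : f θ = θ' ∨ f θ = -θ')
    {φL : (V.baseChange L).toAffine.Point →+ (V'.baseChange L).toAffine.Point}
    {φL' : (V.baseChange L').toAffine.Point →+ (V'.baseChange L').toAffine.Point}
    (hφ : ∀ Q, Affine.Point.map f (φL Q) = φL' (Affine.Point.map f Q))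
    (P : ((V.quadraticTwist d).baseChange L).toAffine.Point) :
    Affine.Point.map f (twistHomAt V V' φL hθ2 hθ P) =
      twistHomAt V V' φL' hθ'2 hθ' (Affine.Point.map f P) := by
  rw [twistHomAt_apply, twistHomAt_apply]
  rcases hf with hf | hf
  · rw [map_untwistEquivAt_symm_of_eq V' hθ2 hθ hθ'2 hθ' f hf, hφ,
      map_untwistEquivAt_of_eq V hθ2 hθ hθ'2 hθ' f hf]
  · rw [map_untwistEquivAt_symm_of_eq_neg V' hθ2 hθ hθ'2 hθ' f hf, hφ,
      map_untwistEquivAt_of_eq_neg V hθ2 hθ hθ'2 hθ' f hf, map_neg, map_neg, neg_neg]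

/-- **Local points maps twist**: if the isogeny `φ : V → V'` (models with `a₁ = a₃ = 0`) has
local points maps, so does its quadratic twist `φ^{(d)} : V^{(d)} → V'^{(d)}`
(`Isogeny.quadraticTwist`). At a `K`-field `E` take `ψ_E = ι'⁻¹ ∘ φ_E ∘ ι` over `K̄_E` with the
root `θ_E = ι_E(√d)`, `ι_E : K̄ → K̄_E` the chosen embedding (`twistHomAt`); compatibility with
`ι_E` is `map_twistHomAt` with the sign `+`, and `Γ_E`-equivariance is `map_twistHomAt` for
`σ ∈ Γ_E`, which sends `θ_E` to `±θ_E`. Cremona, *Algorithms*, §3.9. [folklore] -/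
theorem _root_.Literature.NumberTheory.EllipticCurves.HasLocalPointsMaps.quadraticTwist {φ : Isogeny V V'}
    (hφ : Literature.NumberTheory.EllipticCurves.HasLocalPointsMaps V V' φ.toAddMonoidHom) (hd : d ≠ 0) :
    Literature.NumberTheory.EllipticCurves.HasLocalPointsMaps (V.quadraticTwist d) (V'.quadraticTwist d)
      (φ.quadraticTwist hd).toAddMonoidHom := by
  intro E _ _
  obtain ⟨φE, hφE, hcomp⟩ := hφ E
  have hθ2 : (Literature.NumberTheory.EllipticCurves.closureEmb (K := K) E (geomSqrt d)) ^ 2 =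
      algebraMap K (AlgebraicClosure E) d := by
    rw [← map_pow, geomSqrt_sq, AlgHom.commutes]
  have hθ0 : Literature.NumberTheory.EllipticCurves.closureEmb (K := K) E (geomSqrt d) ≠ 0 :=
    (map_ne_zero _).mpr (geomSqrt_ne_zero hd)
  refine ⟨twistHomAt V V' φE hθ2 hθ0, fun τ P ↦ ?_, fun P ↦ ?_⟩
  · rw [Literature.NumberTheory.EllipticCurves.localPoints.smul_def, Literature.NumberTheory.EllipticCurves.localPoints.smul_def]
    have hsign := sq_eq_sq_iff_eq_or_eq_neg.mp (show
      ((AlgEquiv.restrictScalars K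
          (show AlgebraicClosure E ≃ₐ[E] AlgebraicClosure E from τ) :
            AlgebraicClosure E ≃ₐ[K] AlgebraicClosure E) :
          AlgebraicClosure E →ₐ[K] AlgebraicClosure E)
        (Literature.NumberTheory.EllipticCurves.closureEmb (K := K) E (geomSqrt d)) ^ 2 =
        (Literature.NumberTheory.EllipticCurves.closureEmb (K := K) E (geomSqrt d)) ^ 2 by rw [← map_pow, hθ2, AlgHom.commutes])
    exact (map_twistHomAt hθ2 hθ0 hθ2 hθ0 _ hsign (fun Q ↦ (hφE τ Q).symm) P).symm
  · exact (map_twistHomAt (geomSqrt_sq d) (geomSqrt_ne_zero hd) hθ2 hθ0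
      (Literature.NumberTheory.EllipticCurves.closureEmb (K := K) E) (Or.inl rfl) (fun Q ↦ (hcomp Q).symm) P).symm

end TwistAt

/-! ## Isogenies with local points maps, as a relation -/

section Loc

omit [W.IsTwoTorsionNF] [W.IsElliptic]

/-- **`W` and `W'` are joined by a `K`-isogeny with local points maps**: the relation
`∃ φ : Isogeny W W', HasLocalPointsMaps φ` — the hypothesis under which `ShaIsogeny.lean`
proves `Ш(W'/K)` finite ⇒ `Ш(W/K)` finite (`Isogeny.shaFinite_of_shaFinite`). It implies
`IsIsogenous W W'` and is generated here by the identity, composition, changes of variables,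
Silverman's `2`-isogeny, Vélu's `3`-isogeny and quadratic twisting.

This is a binary *relation* on Weierstrass curves over `K` (explicit binders `W W'`, written on
the declaration itself since 2026-08-15 so that the literature census does not read the line as a
closed named fact `def IsLocIsogenous : Prop`), **not** a statement to be discharged: it fails for
every pair that is not `K`-isogenous (`IsLocIsogenous.isIsogenous`). Its closed mathematical
content — every `K`-isogeny has local points maps, so that `IsLocIsogenous W W' ↔ IsIsogenous W W'`
— is the named fact `WeierstrassCurve.Isogeny.hasLocalPointsMaps W W'` of `ShaIsogeny.lean`
(`isLocIsogenous_iff_isIsogenous`). [folklore] -/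
def IsLocIsogenous (W W' : WeierstrassCurve K) : Prop :=
  ∃ φ : Isogeny W W', Literature.NumberTheory.EllipticCurves.HasLocalPointsMaps W W' φ.toAddMonoidHom

variable {W} {W' W'' : WeierstrassCurve K}

/-- `IsLocIsogenous` refines `IsIsogenous`. [folklore] -/
theorem IsLocIsogenous.isIsogenous (h : IsLocIsogenous W W') : IsIsogenous W W' :=
  h.elim fun φ _ ↦ ⟨φ⟩

/-- **`IsLocIsogenous = IsIsogenous` granted the local points maps of isogenies**: over a perfect
field, under the named fact `Isogeny.hasLocalPointsMaps W W'` (every `K`-isogeny `W → W'` acts,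
equivariantly and compatibly with `K̄ → K̄_E`, on the `K̄_E`-points for every field `E ⊇ K`;
Silverman, *AEC*, III.4 with I.§3, II.§2), `W` and `W'` are joined by an isogeny with local
points maps iff they are `K`-isogenous. [folklore] -/
theorem isLocIsogenous_iff_isIsogenous [PerfectField K] (h : Isogeny.hasLocalPointsMaps W W') :
    IsLocIsogenous W W' ↔ IsIsogenous W W' :=
  ⟨IsLocIsogenous.isIsogenous, fun ⟨φ⟩ ↦ ⟨φ, h φ⟩⟩

variable (W) in
/-- Reflexivity (the identity isogeny, `HasLocalPointsMaps.id`). [folklore] -/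
theorem IsLocIsogenous.refl : IsLocIsogenous W W :=
  ⟨Isogeny.id W, Literature.NumberTheory.EllipticCurves.HasLocalPointsMaps.id⟩

/-- Transitivity (composition of isogenies, `HasLocalPointsMaps.comp`). [folklore] -/
theorem IsLocIsogenous.trans' (h : IsLocIsogenous W W') (h' : IsLocIsogenous W' W'') :
    IsLocIsogenous W W'' := by
  obtain ⟨φ, hφ⟩ := h
  obtain ⟨ψ, hψ⟩ := h'
  exact ⟨ψ.comp φ, hψ.comp hφ⟩

variable (W) in
/-- `W ~ C • W` with local points maps. [folklore] -/
theorem isLocIsogenous_smul (C : VariableChange K) : IsLocIsogenous W (C • W) :=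
  exists_isogeny_hasLocalPointsMaps_of_smul_eq W rfl

variable (W) in
/-- `C • W ~ W` with local points maps. [folklore] -/
theorem isLocIsogenous_of_smul (C : VariableChange K) : IsLocIsogenous (C • W) W :=
  exists_isogeny_hasLocalPointsMaps_of_smul_eq' W rfl

/-- Along `IsLocIsogenous W W'` over a number field, `Ш(W'/K)` finite ⇒ `Ш(W/K)` finite,
unconditionally (`Isogeny.shaFinite_of_shaFinite`). Milne, *ADT*, Lemma I.7.1(b).
[cite: MilneADT2006, Ch. I Lemma 7.1(b), p. 96] -/
theorem IsLocIsogenous.shaFinite_of_shaFinite [NumberField K] [W.IsElliptic] [W'.IsElliptic]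
    (h : IsLocIsogenous W W') (hfin : W'.ShaFinite) : W.ShaFinite := by
  obtain ⟨φ, hφ⟩ := h
  exact φ.shaFinite_of_shaFinite hφ hfin

/-- **Twisting, models with `a₁ = a₃ = 0`** (`HasLocalPointsMaps.quadraticTwist`). [folklore] -/
theorem IsLocIsogenous.quadraticTwist_of_isCharNeTwoNF [NeZero (2 : K)]
    {V V' : WeierstrassCurve K} [V.IsCharNeTwoNF] [V'.IsCharNeTwoNF] (h : IsLocIsogenous V V')
    {d : K} (hd : d ≠ 0) : IsLocIsogenous (V.quadraticTwist d) (V'.quadraticTwist d) := by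
  obtain ⟨φ, hφ⟩ := h
  exact ⟨φ.quadraticTwist hd, hφ.quadraticTwist hd⟩

/-- **Twisting commutes with isogenies, with local points maps**: `W ~ W'` implies
`W^{(d)} ~ W'^{(d)}` for the relation `IsLocIsogenous` (fields with `2 ≠ 0`, `d ≠ 0`); the
reduction to models with `a₁ = a₃ = 0` of the tree's `IsIsogenous.quadraticTwist`, step by
step. Cremona, *Algorithms*, §3.9 (p. 87). [cite: CremonaAlgorithms1997, §3.9 (p. 87)] -/
theorem IsLocIsogenous.quadraticTwist [NeZero (2 : K)] (h : IsLocIsogenous W W') {d : K}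
    (hd : d ≠ 0) : IsLocIsogenous (W.quadraticTwist d) (W'.quadraticTwist d) := by
  letI : Invertible (2 : K) := invertibleOfNonzero two_ne_zero
  have h₀ : IsLocIsogenous (W.toCharNeTwoNF • W) (W'.toCharNeTwoNF • W') :=
    ((isLocIsogenous_of_smul W _).trans' h).trans' (isLocIsogenous_smul W' _)
  have h₁ : IsLocIsogenous ((W.toCharNeTwoNF • W).quadraticTwist d)
      ((W'.toCharNeTwoNF • W').quadraticTwist d) :=
    h₀.quadraticTwist_of_isCharNeTwoNF hd
  rw [quadraticTwist_smul, quadraticTwist_smul] at h₁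
  exact ((isLocIsogenous_smul _ _).trans' h₁).trans' (isLocIsogenous_of_smul _ _)

end Loc

/-- Silverman's `2`-isogeny joins `W` to `W.twoIsogenyCodomain` with local points maps.
[folklore] -/
theorem isLocIsogenous_twoIsogenyCodomain : IsLocIsogenous W W.twoIsogenyCodomain :=
  ⟨W.twoIsogeny, hasLocalPointsMaps_twoIsogeny W⟩

/-- The same for any equation *equal* to the codomain (literal equations). [folklore] -/
theorem isLocIsogenous_of_eq_twoIsogenyCodomain {W' : WeierstrassCurve K}
    (h : W.twoIsogenyCodomain = W') : IsLocIsogenous W W' :=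
  h ▸ isLocIsogenous_twoIsogenyCodomain W

omit [W.IsTwoTorsionNF] [W.IsElliptic] in
/-- Vélu's `3`-isogeny joins a Vélu pair with local points maps. [folklore] -/
theorem IsVeluThreePair.isLocIsogenous {m s : K} {V V' : WeierstrassCurve K}
    (h : IsVeluThreePair m s V V') : IsLocIsogenous V V' :=
  ⟨h.toIsogeny, h.hasLocalPointsMaps_toIsogeny⟩

end WeierstrassCurve



end
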